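import Mathlib
import HarnessLib
import Literature.Computability.LeeEtAl2017.PoisonSemantics

/-!
# LLVM Language Reference Manual, release 18.1.3: the integer binary operators, `icmp`, `select`, `freeze` and `*.with.overflow`

Source followed verbatim: *LLVM Language Reference Manual*, release 18.1.3 [LLVMLangRef18] — `docs/LangRef.rst` at tag
`llvmorg-18.1.3` (pinned copy `inputs/llvm-18.1.3.src/docs/LangRef.rst` of the CertifiedToolchain cell, 28 110 lines).  Companion of
`IntegerIntrinsics.lean` (min/max/abs, saturating ops, bit counting, casts).  Every declaration carries the section title and the LINE RANGE of
the pinned file it transcribes, with the normative sentence quoted.  Typed here because the printed papers (`LopesEtAl2015` Alive PLDI'15,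
`LeeEtAl2017` PLDI'17, `LopesEtAl2021` Alive2 PLDI'21) predate or omit some of these constructs — notably the `or disjoint` flag (L10073–10077),
which no paper prints — and because the manual is the normative specification the pinned compiler ships.

Printed (§'Poison Values', L4561–4568): "This means that immediate undefined behavior occurs if a poison value is used as an instruction operand
that has any values that trigger undefined behavior. Notably this includes (but is not limited to): […] -  The divisor operand of a ``udiv``,
``sdiv``, ``urem`` or ``srem`` instruction."
Printed (§'add', L9261–9273; §'sub' L9356–9368 and §'mul' L9450–9466 identical up to the operation): "The value produced is the integer sum of the
two operands. If the sum has unsigned overflow, the result returned is the mathematical result modulo 2^n, where n is the bit width of the result. […]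
``nuw`` and ``nsw`` stand for "No Unsigned Wrap" and "No Signed Wrap", respectively. If the ``nuw`` and/or ``nsw`` keywords are present, the result
value of the ``add`` is a poison value if unsigned and/or signed overflow, respectively, occurs."
Printed (§'udiv', L9544–9555): "The value produced is the unsigned integer quotient of the two operands. […] Division by zero is undefined behavior.
[…] If the ``exact`` keyword is present, the result value of the ``udiv`` is a poison value if %op1 is not a multiple of %op2 (as such,
"((a udiv exact b) mul b) == a")."  (§'sdiv', L9592–9604): "The value produced is the signed integer quotient of the two operands rounded towards
zero. […] Division by zero is undefined behavior. […] Overflow also leads to undefined behavior; this is a rare case, but can occur, for example, by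
doing a 32-bit division of -2147483648 by -1. If the ``exact`` keyword is present, the result value of the ``sdiv`` is a poison value if the result
would be rounded."  (§'urem', L9682–9691): "This instruction returns the unsigned integer *remainder* of a division. […] Taking the remainder of a
division by zero is undefined behavior."  (§'srem', L9730–9750): "This instruction returns the *remainder* of a division (where the result is either
zero or has the same sign as the dividend, ``op1``) […] Taking the remainder of a division by zero is undefined behavior. […] Overflow also leads to
undefined behavior; this is a rare case, but can occur, for example, by taking the remainder of a 32-bit division of -2147483648 by -1."
Printed (§'shl', L9852–9862): "The value produced is ``op1`` * 2^op2 mod 2^n, where ``n`` is the width of the result. If ``op2`` is (statically or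
dynamically) equal to or larger than the number of bits in ``op1``, this instruction returns a poison value. […] If the ``nuw`` keyword is present,
then the shift produces a poison value if it shifts out any non-zero bits. If the ``nsw`` keyword is present, then the shift produces a poison value
if it shifts out any bits that disagree with the resultant sign bit."  (§'lshr', L9905–9913): "This instruction always performs a logical shift right
operation. The most significant bits of the result will be filled with zero bits after the shift. If ``op2`` is (statically or dynamically) equal to
or larger than the number of bits in ``op1``, this instruction returns a poison value. […] If the ``exact`` keyword is present, the result value of the
``lshr`` is a poison value if any of the bits shifted out are non-zero."  (§'ashr', L9957–9965): "This instruction always performs an arithmetic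
shift right operation, The most significant bits of the result will be filled with the sign bit of ``op1``. If ``op2`` is (statically or dynamically)
equal to or larger than the number of bits in ``op1``, this instruction returns a poison value. […] If the ``exact`` keyword is present, the result
value of the ``ashr`` is a poison value if any of the bits shifted out are non-zero."
Printed (§'and'/'or'/'xor', L10007–10019 / L10059–10077 / L10117–10129): the three truth tables, and for `or`: "``disjoint`` means that for each bit,
that bit is zero in at least one of the inputs. This allows the Or to be treated as an Add since no carry can occur from any bit. If the disjoint
keyword is present, the result value of the ``or`` is a poison value if both inputs have a one in the same bit position."
Printed (§'icmp', L11892–11917): "The '``icmp``' compares ``op1`` and ``op2`` according to the condition code given as ``cond``. […] ``eq``: yields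
``true`` if the operands are equal […]. ``ugt``: interprets the operands as unsigned values and yields ``true`` if ``op1`` is greater than ``op2``.
[…] ``slt``: interprets the operands as signed values and yields ``true`` if ``op1`` is less than ``op2``. […]"
Printed (§'select', L12147–12149): "If the condition is an i1 and it evaluates to 1, the instruction returns the first value argument; otherwise, it
returns the second value argument."  (§'Poison Values', L4553–4554): "Most instructions return '``poison``' when one of their arguments is
'``poison``'. A notable exception is the select instruction."
Printed (§'freeze', L12191–12196): "If the argument is ``undef`` or ``poison``, '``freeze``' returns an arbitrary, but fixed, value of type
'``ty``'. Otherwise, this instruction is a no-op and returns the input argument. All uses of a value returned by the same '``freeze``' instruction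
are guaranteed to always observe the same value".  (§'Well-Defined Values', L4614–4615): "The result of freeze instruction is well defined regardless
of its operand."
Printed (§'llvm.sadd.with.overflow.*', L16432–16436): "They return a structure --- the first element of which is the signed summation, and the second
element of which is a bit specifying if the signed summation resulted in an overflow." (uadd L16483–16486 "a carry"; ssub L16534–16538; usub
L16585–16589; smul L16635–16639; umul L16686–16690 likewise).

## What is formalised and what is not
Scalar integers only (the vector clauses of every section are omitted).  The value domain is `⟦iw⟧ = LeeEtAl2017.IVal w` (poison-or-defined, no
`undef`); instructions that can raise immediate undefined behavior return `OrUB w = Option (IVal w)` with `none` = UB.  "Unsigned/signed overflow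
occurs" is formalised by Lean core's `BitVec.uaddOverflow` / `saddOverflow` / `usubOverflow` / `ssubOverflow` / `umulOverflow` / `smulOverflow`
(the exact sum/difference/product lies outside the unsigned / two's-complement range — the manual's own meaning of the words).  Bit phrases are typed
BIT-LEVEL as printed (`ShiftsOutNonZero`, `ShiftsOutSignDisagree`, `LowBitsNonZero`, `CommonOne`) and then proved equal to the arithmetic tests that
verification tools use (`shiftsOutNonZero_iff`, `lowBitsNonZero_iff`, `commonOne_iff`).  The poison-DIVIDEND-with-divisor-`-1` clause of `sdiv`/`srem`
is the L4561–4563 sentence applied to ``op1`` (a poison value "used as an instruction operand that has any values that trigger undefined behavior",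
here `INT_MIN`): typed that way and flagged as a READING of that sentence (the divisor bullet L4567–4568 is explicit, the dividend case is covered only
by the general sentence).  NOT stated by the manual and NOT typed as its text: the result of `select` on a poison CONDITION (the select section
L12144–12149 is silent; §'Poison Values' only calls select "a notable exception") — `LeeEtAl2017.IVal.select` (PLDI'17 Fig. 5: poison) is the printed
rule the cell uses, and `select_defined_eq` records that the two agree wherever the manual speaks.  Nothing about `undef`, pointers, vectors,
fast-math flags, or what LLVM's optimiser does; this is the specification text only.
-/

namespace Literature.Computability.LLVMLangRef18

open Literature.Computability.LeeEtAl2017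

variable {w : ℕ}

/-! ## Results that may be immediate undefined behavior -/

/-- `none` = immediate undefined behavior, `some v` = a value of `⟦iw⟧` (possibly poison): the result type of `udiv`/`sdiv`/`urem`/`srem`.
[cite: LLVMLangRef18, §'Poison Values' L4561–4568; §'udiv' L9549] -/
abbrev OrUB (w : ℕ) := Option (IVal w)

/-- Immediate undefined behavior. [cite: LLVMLangRef18, §'udiv' L9549 "Division by zero is undefined behavior"] -/
abbrev OrUB.ub : OrUB w := none

/-! ## `add`, `sub`, `mul` with `nuw` / `nsw` (§'add' L9233–9281, §'sub' L9325–9377, §'mul' L9422–9474) -/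

/-- `add [nuw] [nsw]` on defined operands: the sum modulo `2^n`, or poison "if unsigned and/or signed overflow, respectively, occurs" under
the corresponding keyword. [cite: LLVMLangRef18, §'add' L9261–9273] -/
def addV (nuw nsw : Bool) (x y : BitVec w) : IVal w :=
  if (nuw && BitVec.uaddOverflow x y) || (nsw && BitVec.saddOverflow x y) then IVal.poison else some (x + y)

/-- `sub [nuw] [nsw]` on defined operands. [cite: LLVMLangRef18, §'sub' L9356–9368] -/
def subV (nuw nsw : Bool) (x y : BitVec w) : IVal w :=
  if (nuw && BitVec.usubOverflow x y) || (nsw && BitVec.ssubOverflow x y) then IVal.poison else some (x - y)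

/-- `mul [nuw] [nsw]` on defined operands. [cite: LLVMLangRef18, §'mul' L9450–9466] -/
def mulV (nuw nsw : Bool) (x y : BitVec w) : IVal w :=
  if (nuw && BitVec.umulOverflow x y) || (nsw && BitVec.smulOverflow x y) then IVal.poison else some (x * y)

/-- `add` on `⟦iw⟧` (poison-strict, §'Poison Values' L4553–4554). [cite: LLVMLangRef18, §'add' L9261–9273] -/
def add (nuw nsw : Bool) (a b : IVal w) : IVal w := IVal.strict₂ (addV nuw nsw) a b
/-- `sub` on `⟦iw⟧`. [cite: LLVMLangRef18, §'sub' L9356–9368] -/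
def sub (nuw nsw : Bool) (a b : IVal w) : IVal w := IVal.strict₂ (subV nuw nsw) a b
/-- `mul` on `⟦iw⟧`. [cite: LLVMLangRef18, §'mul' L9450–9466] -/
def mul (nuw nsw : Bool) (a b : IVal w) : IVal w := IVal.strict₂ (mulV nuw nsw) a b

/-- Without keywords the result is always the modular sum: "the result returned is the mathematical result modulo 2^n".
[cite: LLVMLangRef18, §'add' L9263–9265] -/
@[simp] theorem addV_plain (x y : BitVec w) : addV false false x y = some (x + y) := by simp [addV]

/-- "the mathematical result modulo 2^n": the returned value's integer is `(x + y) mod 2^n`. [cite: LLVMLangRef18, §'add' L9263–9265] -/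
theorem addV_plain_toNat (x y : BitVec w) : ((x + y).toNat : ℕ) = (x.toNat + y.toNat) % 2 ^ w := BitVec.toNat_add x y

/-- `nuw`: poison exactly when the unsigned sum overflows. [cite: LLVMLangRef18, §'add' L9270–9273] -/
theorem addV_nuw_eq_poison_iff (x y : BitVec w) : addV true false x y = IVal.poison ↔ BitVec.uaddOverflow x y = true := by
  unfold addV; split <;> simp_all [IVal.poison]

/-- `nsw`: poison exactly when the signed sum overflows. [cite: LLVMLangRef18, §'add' L9270–9273] -/
theorem addV_nsw_eq_poison_iff (x y : BitVec w) : addV false true x y = IVal.poison ↔ BitVec.saddOverflow x y = true := by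
  unfold addV; split <;> simp_all [IVal.poison]

/-- The printed example of §'Poison Values' (L4584): `%poison = sub nuw i32 0, 1 ; Results in a poison value.`
[cite: LLVMLangRef18, §'Poison Values' L4584] -/
theorem sub_nuw_zero_one_poison : subV (w := 32) true false 0#32 1#32 = IVal.poison := by decide

/-- The printed example L4585: `%poison2 = sub i32 poison, 1 ; Also results in a poison value.` [cite: LLVMLangRef18, §'Poison Values' L4585] -/
theorem sub_poison_left (nuw nsw : Bool) (b : IVal w) : sub nuw nsw IVal.poison b = IVal.poison := rfl

/-! ## `udiv`, `sdiv`, `urem`, `srem` (§'udiv' L9518–9563, §'sdiv' L9566–9612, §'urem' L9656–9699, §'srem' L9702–9758) -/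

/-- `udiv [exact] a, b`: UB if the divisor is poison (§'Poison Values' L4567–4568) or zero ("Division by zero is undefined behavior", L9549);
poison if the dividend is poison (L4553–4554); under `exact`, poison "if %op1 is not a multiple of %op2 (as such, "((a udiv exact b) mul b) == a")"
(L9553–9555); else "the unsigned integer quotient" (L9544). [cite: LLVMLangRef18, §'udiv' L9544–9555; §'Poison Values' L4561–4568] -/
def udiv (exact : Bool) (a b : IVal w) : OrUB w :=
  match b with
  | none => none
  | some y => if y = 0#w then none else
      some (a.bind fun x => if exact ∧ x / y * y ≠ x then IVal.poison else some (x / y))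

/-- `urem a, b`: UB if the divisor is poison or zero (L9689, L4567–4568); poison if the dividend is poison; else "the unsigned integer remainder
of a division" (L9682). [cite: LLVMLangRef18, §'urem' L9682–9691; §'Poison Values' L4561–4568] -/
def urem (a b : IVal w) : OrUB w :=
  match b with
  | none => none
  | some y => if y = 0#w then none else some (a.bind fun x => some (x % y))

/-- `sdiv [exact] a, b`: UB if the divisor is poison or zero (L9598, L4567–4568), or on overflow — "a 32-bit division of -2147483648 by -1"
(L9600–9601) — including a poison DIVIDEND with divisor `-1` (reading of L4561–4563: the operand "has a value", `INT_MIN`, "that triggers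
undefined behavior"); poison if the dividend is poison otherwise; under `exact`, poison "if the result would be rounded" (L9603–9604); else "the
signed integer quotient of the two operands rounded towards zero" (L9592–9593, `BitVec.sdiv`).
[cite: LLVMLangRef18, §'sdiv' L9592–9604; §'Poison Values' L4561–4568] -/
def sdiv (exact : Bool) (a b : IVal w) : OrUB w :=
  match b with
  | none => none
  | some y => if y = 0#w then none else
      match a with
      | none => if y = BitVec.allOnes w then none else some IVal.poison
      | some x => if x = BitVec.intMin w ∧ y = BitVec.allOnes w then none else
          some (if exact ∧ x.sdiv y * y ≠ x then IVal.poison else some (x.sdiv y))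

/-- `srem a, b`: same definedness as `sdiv` ("Overflow also leads to undefined behavior […] by taking the remainder of a 32-bit division of
-2147483648 by -1", L9746–9750); value "either zero or has the same sign as the dividend" = `BitVec.srem` (remainder of truncated division).
[cite: LLVMLangRef18, §'srem' L9730–9750; §'Poison Values' L4561–4568] -/
def srem (a b : IVal w) : OrUB w :=
  match b with
  | none => none
  | some y => if y = 0#w then none else
      match a with
      | none => if y = BitVec.allOnes w then none else some IVal.poison
      | some x => if x = BitVec.intMin w ∧ y = BitVec.allOnes w then none else some (some (x.srem y))

/-- "Division by zero is undefined behavior." [cite: LLVMLangRef18, §'udiv' L9549] -/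
@[simp] theorem udiv_zero (exact : Bool) (a : IVal w) : udiv exact a (some 0#w) = none := by simp [udiv]

/-- A poison divisor is immediate UB. [cite: LLVMLangRef18, §'Poison Values' L4567–4568] -/
@[simp] theorem udiv_poison_divisor (exact : Bool) (a : IVal w) : udiv exact a IVal.poison = none := rfl

/-- "Taking the remainder of a division by zero is undefined behavior." [cite: LLVMLangRef18, §'urem' L9689] -/
@[simp] theorem urem_zero (a : IVal w) : urem a (some 0#w) = none := by simp [urem]

/-- The printed overflow example: "a 32-bit division of -2147483648 by -1" is undefined behavior. [cite: LLVMLangRef18, §'sdiv' L9600–9601] -/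
theorem sdiv_intMin_negOne_32 : sdiv false (some (BitVec.intMin 32)) (some (BitVec.allOnes 32)) = none := by decide

/-- … and so is "the remainder of a 32-bit division of -2147483648 by -1". [cite: LLVMLangRef18, §'srem' L9746–9748] -/
theorem srem_intMin_negOne_32 : srem (some (BitVec.intMin 32)) (some (BitVec.allOnes 32)) = none := by decide

/-- The `exact` clause as printed, "((a udiv exact b) mul b) == a", is the divisibility test `a % b = 0`.
[cite: LLVMLangRef18, §'udiv' L9553–9555] -/
theorem udiv_mul_eq_iff_umod_eq_zero (x y : BitVec w) : x / y * y = x ↔ x % y = 0#w := by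
  constructor
  · intro e
    have e' := congrArg BitVec.toNat e
    simp only [BitVec.toNat_mul, BitVec.toNat_udiv] at e'
    apply BitVec.eq_of_toNat_eq
    simp only [BitVec.toNat_umod, BitVec.toNat_ofNat, Nat.zero_mod]
    have hx := x.isLt
    have hdm := Nat.div_add_mod x.toNat y.toNat
    have hle : x.toNat / y.toNat * y.toNat ≤ x.toNat := Nat.div_mul_le_self _ _
    rw [Nat.mod_eq_of_lt (lt_of_le_of_lt hle hx)] at e'
    rw [Nat.mul_comm] at hdm
    omega
  · intro e
    have e' := congrArg BitVec.toNat e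
    simp only [BitVec.toNat_umod, BitVec.toNat_ofNat, Nat.zero_mod] at e'
    apply BitVec.eq_of_toNat_eq
    simp only [BitVec.toNat_mul, BitVec.toNat_udiv]
    have hx := x.isLt
    have hdm := Nat.div_add_mod x.toNat y.toNat
    have hle : x.toNat / y.toNat * y.toNat ≤ x.toNat := Nat.div_mul_le_self _ _
    rw [Nat.mod_eq_of_lt (lt_of_le_of_lt hle hx)]
    rw [Nat.mul_comm] at hdm
    omega

/-! ## `shl`, `lshr`, `ashr` with `nuw` / `nsw` / `exact` (§'shl' L9823–9875, §'lshr' L9878–9926, §'ashr' L9929–9978) -/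

/-- "shifts out any non-zero bits" (`shl` by `s < n`): some bit of ``op1`` at a position `≥ n − s` is set. [cite: LLVMLangRef18, §'shl' L9859–9860] -/
def ShiftsOutNonZero (x : BitVec w) (s : ℕ) : Prop := ∃ i, i < w ∧ w - s ≤ i ∧ x.getLsbD i = true

/-- "shifts out any bits that disagree with the resultant sign bit" (`shl nsw` by `s < n`): some shifted-out bit of ``op1`` (position `≥ n − s`)
differs from the sign bit of the result, which is bit `n − 1 − s` of ``op1``. [cite: LLVMLangRef18, §'shl' L9861–9862] -/
def ShiftsOutSignDisagree (x : BitVec w) (s : ℕ) : Prop := ∃ i, i < w ∧ w - s ≤ i ∧ x.getLsbD i ≠ x.getLsbD (w - 1 - s)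

/-- "any of the bits shifted out are non-zero" (`lshr`/`ashr exact` by `s`): some bit of ``op1`` at a position `< s` is set.
[cite: LLVMLangRef18, §'lshr' L9912–9913; §'ashr' L9964–9965] -/
def LowBitsNonZero (x : BitVec w) (s : ℕ) : Prop := ∃ i, i < s ∧ x.getLsbD i = true

/-- The bit phrase is decidable (finitely many positions). [cite: LLVMLangRef18, §'shl' L9859–9860] -/
instance (x : BitVec w) (s : ℕ) : Decidable (ShiftsOutNonZero x s) := by
  unfold ShiftsOutNonZero
  exact decidable_of_iff (∃ i < w, w - s ≤ i ∧ x.getLsbD i = true) (by simp)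
/-- Decidable likewise. [cite: LLVMLangRef18, §'shl' L9861–9862] -/
instance (x : BitVec w) (s : ℕ) : Decidable (ShiftsOutSignDisagree x s) := by
  unfold ShiftsOutSignDisagree
  exact decidable_of_iff (∃ i < w, w - s ≤ i ∧ x.getLsbD i ≠ x.getLsbD (w - 1 - s)) (by simp)
/-- Decidable likewise. [cite: LLVMLangRef18, §'lshr' L9912–9913] -/
instance (x : BitVec w) (s : ℕ) : Decidable (LowBitsNonZero x s) := by
  unfold LowBitsNonZero
  exact decidable_of_iff (∃ i < s, x.getLsbD i = true) (by simp)

/-- `shl [nuw] [nsw] op1, op2` on defined operands: poison if `op2 ≥ n` (L9853–9855) or a keyword's condition holds (L9859–9862); else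
`op1 * 2^op2 mod 2^n` = `op1 <<< op2` (L9852). [cite: LLVMLangRef18, §'shl' L9852–9862] -/
def shlV (nuw nsw : Bool) (x s : BitVec w) : IVal w :=
  if w ≤ s.toNat then IVal.poison
  else if (nuw ∧ ShiftsOutNonZero x s.toNat) ∨ (nsw ∧ ShiftsOutSignDisagree x s.toNat) then IVal.poison
  else some (x <<< s.toNat)

/-- `lshr [exact] op1, op2` on defined operands: poison if `op2 ≥ n` (L9907–9909) or, under `exact`, "if any of the bits shifted out are non-zero"
(L9912–9913); else the logical right shift with zero fill (L9905–9907). [cite: LLVMLangRef18, §'lshr' L9905–9913] -/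
def lshrV (exact : Bool) (x s : BitVec w) : IVal w :=
  if w ≤ s.toNat then IVal.poison
  else if exact ∧ LowBitsNonZero x s.toNat then IVal.poison
  else some (x >>> s.toNat)

/-- `ashr [exact] op1, op2` on defined operands: poison if `op2 ≥ n` (L9959–9961) or, under `exact`, if any shifted-out bit is non-zero
(L9964–9965); else the arithmetic right shift, "filled with the sign bit of ``op1``" (L9957–9959, `BitVec.sshiftRight`).
[cite: LLVMLangRef18, §'ashr' L9957–9965] -/
def ashrV (exact : Bool) (x s : BitVec w) : IVal w :=
  if w ≤ s.toNat then IVal.poison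
  else if exact ∧ LowBitsNonZero x s.toNat then IVal.poison
  else some (x.sshiftRight s.toNat)

/-- `shl` on `⟦iw⟧`. [cite: LLVMLangRef18, §'shl' L9852–9862; §'Poison Values' L4553–4554] -/
def shl (nuw nsw : Bool) (a b : IVal w) : IVal w := IVal.strict₂ (shlV nuw nsw) a b
/-- `lshr` on `⟦iw⟧`. [cite: LLVMLangRef18, §'lshr' L9905–9913] -/
def lshr (exact : Bool) (a b : IVal w) : IVal w := IVal.strict₂ (lshrV exact) a b
/-- `ashr` on `⟦iw⟧`. [cite: LLVMLangRef18, §'ashr' L9957–9965] -/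
def ashr (exact : Bool) (a b : IVal w) : IVal w := IVal.strict₂ (ashrV exact) a b

/-- "The value produced is ``op1`` * 2^op2 mod 2^n". [cite: LLVMLangRef18, §'shl' L9852–9853] -/
theorem shl_toNat (x : BitVec w) (s : ℕ) : (x <<< s).toNat = x.toNat * 2 ^ s % 2 ^ w := by
  rw [BitVec.toNat_shiftLeft, Nat.shiftLeft_eq]

/-- An over-wide shift amount gives poison, whatever the keywords. [cite: LLVMLangRef18, §'shl' L9853–9855] -/
theorem shlV_of_le {x s : BitVec w} (h : w ≤ s.toNat) (nuw nsw : Bool) : shlV nuw nsw x s = IVal.poison := by simp [shlV, h]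

/-- **"shifts out any non-zero bits" is the arithmetic test `2^n ≤ op1 · 2^op2`** (the product does not fit `n` bits), for `s < n`.
[cite: LLVMLangRef18, §'shl' L9859–9860] -/
theorem shiftsOutNonZero_iff (x : BitVec w) {s : ℕ} (hs : s < w) : ShiftsOutNonZero x s ↔ 2 ^ w ≤ x.toNat * 2 ^ s := by
  constructor
  · rintro ⟨i, hiw, hi, hbit⟩
    have hge : 2 ^ i ≤ x.toNat := Nat.ge_two_pow_of_testBit hbit
    calc 2 ^ w ≤ 2 ^ (i + s) := Nat.pow_le_pow_right (by norm_num) (by omega)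
      _ = 2 ^ i * 2 ^ s := by rw [Nat.pow_add]
      _ ≤ x.toNat * 2 ^ s := Nat.mul_le_mul_right _ hge
  · intro h
    by_contra hne
    simp only [ShiftsOutNonZero, not_exists, not_and, Bool.not_eq_true] at hne
    have hlt : x.toNat < 2 ^ (w - s) := by
      refine Nat.lt_pow_two_of_testBit _ (fun i hi => ?_)
      by_cases hiw : i < w
      · exact hne i hiw hi
      · exact Nat.testBit_lt_two_pow (lt_of_lt_of_le x.isLt (Nat.pow_le_pow_right (by norm_num) (by omega)))
    have : x.toNat * 2 ^ s < 2 ^ (w - s) * 2 ^ s := Nat.mul_lt_mul_of_pos_right hlt (Nat.two_pow_pos s)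
    rw [← Nat.pow_add, Nat.sub_add_cancel hs.le] at this
    omega

/-- **"any of the bits shifted out are non-zero" is the arithmetic test `op1 mod 2^op2 ≠ 0`.** [cite: LLVMLangRef18, §'lshr' L9912–9913] -/
theorem lowBitsNonZero_iff (x : BitVec w) (s : ℕ) : LowBitsNonZero x s ↔ x.toNat % 2 ^ s ≠ 0 := by
  constructor
  · rintro ⟨i, hi, hbit⟩ h0
    have : (x.toNat % 2 ^ s).testBit i = true := by rw [Nat.testBit_mod_two_pow]; simp [hi, BitVec.getLsbD] at hbit ⊢; exact hbit
    rw [h0] at this; simp at this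
  · intro h
    by_contra hne
    simp only [LowBitsNonZero, not_exists, not_and, Bool.not_eq_true] at hne
    apply h
    apply Nat.eq_of_testBit_eq
    intro i
    rw [Nat.testBit_mod_two_pow, Nat.zero_testBit]
    by_cases hi : i < s
    · simp [hi]; exact hne i hi
    · simp [hi]

/-! ## `and`, `or [disjoint]`, `xor` (§'and' L9981–10029, §'or' L10032–10086, §'xor' L10090–10139) -/

/-- "both inputs have a one in the same bit position". [cite: LLVMLangRef18, §'or' L10075–10077] -/
def CommonOne (x y : BitVec w) : Prop := ∃ i, i < w ∧ x.getLsbD i = true ∧ y.getLsbD i = true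

/-- Decidable (finitely many positions). [cite: LLVMLangRef18, §'or' L10075–10077] -/
instance (x y : BitVec w) : Decidable (CommonOne x y) := by
  unfold CommonOne; exact decidable_of_iff (∃ i < w, x.getLsbD i = true ∧ y.getLsbD i = true) (by simp)

/-- `or [disjoint]` on defined operands: the bitwise inclusive or (truth table L10061–10071); "If the disjoint keyword is present, the result value
of the ``or`` is a poison value if both inputs have a one in the same bit position" (L10075–10077). [cite: LLVMLangRef18, §'or' L10059–10077] -/
def orV (disjoint : Bool) (x y : BitVec w) : IVal w :=
  if disjoint ∧ CommonOne x y then IVal.poison else some (x ||| y)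

/-- `and` on `⟦iw⟧` = `LeeEtAl2017.IVal.and` (truth table L10009–10019). [cite: LLVMLangRef18, §'and' L10007–10019] -/
def and (a b : IVal w) : IVal w := IVal.strict₂ (fun x y => some (x &&& y)) a b
/-- `or [disjoint]` on `⟦iw⟧`. [cite: LLVMLangRef18, §'or' L10059–10077] -/
def or (disjoint : Bool) (a b : IVal w) : IVal w := IVal.strict₂ (orV disjoint) a b
/-- `xor` on `⟦iw⟧` (truth table L10119–10129; "used to implement the "one's complement" operation", L10103–10105). [cite: LLVMLangRef18, §'xor' L10117–10129] -/
def xor (a b : IVal w) : IVal w := IVal.strict₂ (fun x y => some (x ^^^ y)) a b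

/-- The three truth tables, bit by bit. [cite: LLVMLangRef18, §'and' L10009–10019; §'or' L10061–10071; §'xor' L10119–10129] -/
theorem truthTables (x y : BitVec w) (i : ℕ) :
    (x &&& y).getLsbD i = (x.getLsbD i && y.getLsbD i) ∧ (x ||| y).getLsbD i = (x.getLsbD i || y.getLsbD i) ∧
      (x ^^^ y).getLsbD i = (x.getLsbD i ^^ y.getLsbD i) := by
  simp

/-- `xor` with all-ones is the one's complement ("the "~" operator in C"). [cite: LLVMLangRef18, §'xor' L10103–10105] -/
theorem xor_allOnes (x : BitVec w) : x ^^^ BitVec.allOnes w = ~~~x := BitVec.xor_allOnes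

/-- **"both inputs have a one in the same bit position" is the test `op1 &&& op2 ≠ 0`.** [cite: LLVMLangRef18, §'or' L10075–10077] -/
theorem commonOne_iff (x y : BitVec w) : CommonOne x y ↔ x &&& y ≠ 0#w := by
  constructor
  · rintro ⟨i, hi, hx, hy⟩ h0
    have := congrArg (fun z => BitVec.getLsbD z i) h0
    simp [hx, hy] at this
  · intro h
    by_contra hne
    simp only [CommonOne, not_exists, not_and] at hne
    apply h
    apply BitVec.eq_of_getLsbD_eq_iff.2
    intro i hi
    simp only [BitVec.getLsbD_and, BitVec.getLsbD_zero, Bool.and_eq_false_imp]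
    intro hx
    cases hy : y.getLsbD i
    · rfl
    · exact absurd hy (hne i hi hx)

/-- "This allows the Or to be treated as an Add since no carry can occur from any bit": without a common one, `or = add`.
[cite: LLVMLangRef18, §'or' L10073–10075] -/
theorem or_eq_add_of_not_commonOne {x y : BitVec w} (h : ¬ CommonOne x y) : x ||| y = x + y := by
  rw [commonOne_iff, not_not] at h
  exact (BitVec.add_eq_or_of_and_eq_zero x y h).symm

/-- Without the keyword `or` is never poison on defined operands. [cite: LLVMLangRef18, §'or' L10059–10071] -/
@[simp] theorem orV_plain (x y : BitVec w) : orV false x y = some (x ||| y) := by simp [orV]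

/-! ## `icmp` (§'icmp' L11848–11936) -/

/-- The ten condition codes. [cite: LLVMLangRef18, §'icmp' L11874–11883] -/
inductive Cond | eq | ne | ugt | uge | ult | ule | sgt | sge | slt | sle
  deriving DecidableEq, Repr

/-- The comparison on defined operands, clause by clause: `eq`/`ne` "No sign interpretation is necessary", `u*` "interprets the operands as
unsigned values", `s*` "interprets the operands as signed values". [cite: LLVMLangRef18, §'icmp' L11898–11917] -/
def icmpV : Cond → BitVec w → BitVec w → Bool
  | .eq, x, y => decide (x = y)
  | .ne, x, y => decide (x ≠ y)
  | .ugt, x, y => decide (y.toNat < x.toNat)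
  | .uge, x, y => decide (y.toNat ≤ x.toNat)
  | .ult, x, y => decide (x.toNat < y.toNat)
  | .ule, x, y => decide (x.toNat ≤ y.toNat)
  | .sgt, x, y => decide (y.toInt < x.toInt)
  | .sge, x, y => decide (y.toInt ≤ x.toInt)
  | .slt, x, y => decide (x.toInt < y.toInt)
  | .sle, x, y => decide (x.toInt ≤ y.toInt)

/-- `icmp` on `⟦iw⟧`, "yields either an i1 […] result" (L11893–11894); poison-strict (L4553–4554; the printed example L4597
`%cmp = icmp slt i32 %poison, 0 ; Returns a poison value`). [cite: LLVMLangRef18, §'icmp' L11892–11917; §'Poison Values' L4597] -/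
def icmp (c : Cond) (a b : IVal w) : IVal 1 := IVal.strict₂ (fun x y => some (BitVec.ofBool (icmpV c x y))) a b

/-- The printed example L4597: comparing a poison value gives poison. [cite: LLVMLangRef18, §'Poison Values' L4597] -/
theorem icmp_poison_left (c : Cond) (b : IVal w) : icmp c IVal.poison b = IVal.poison := rfl

/-- The unsigned codes agree with Lean's `BitVec.ult` / `ule`. [cite: LLVMLangRef18, §'icmp' L11906–11909] -/
theorem icmpV_ult (x y : BitVec w) : icmpV .ult x y = x.ult y ∧ icmpV .ule x y = x.ule y := by
  simp [icmpV, BitVec.ult, BitVec.ule]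

/-- The signed codes agree with Lean's `BitVec.slt` / `sle`. [cite: LLVMLangRef18, §'icmp' L11914–11917] -/
theorem icmpV_slt (x y : BitVec w) : icmpV .slt x y = x.slt y ∧ icmpV .sle x y = x.sle y := by
  simp [icmpV, BitVec.slt, BitVec.sle]

/-! ## `select` (§'select' L12113–12163) and `freeze` (§'freeze' L12167–12233) -/

/-- `select` with a DEFINED `i1` condition: "If the condition is an i1 and it evaluates to 1, the instruction returns the first value argument;
otherwise, it returns the second value argument." (The manual does not state the poison-condition case; see the module docstring.)
[cite: LLVMLangRef18, §'select' L12147–12149] -/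
def selectV (c : BitVec 1) (a b : IVal w) : IVal w := if c = 1#1 then a else b

/-- "A notable exception is the select instruction": the unselected operand's poison does not propagate. [cite: LLVMLangRef18, §'Poison Values' L4553–4554; §'select' L12147–12149] -/
theorem selectV_ignores_unselected (a b : IVal w) : selectV 1#1 a IVal.poison = a ∧ selectV 0#1 IVal.poison b = b := by
  simp [selectV]

/-- Wherever the manual speaks (defined condition) it agrees with PLDI'17 Fig. 5 (`LeeEtAl2017.IVal.select`). [cite: LLVMLangRef18, §'select' L12147–12149] -/
theorem select_defined_eq (c : BitVec 1) (a b : IVal w) : selectV c a b = IVal.select (some c) a b := by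
  have hc : c = 0#1 ∨ c = 1#1 := by
    have := c.isLt
    rcases c with ⟨n, hn⟩
    have : n = 0 ∨ n = 1 := by omega
    rcases this with rfl | rfl <;> simp
  rcases hc with rfl | rfl <;> simp [selectV]

/-- `freeze` on `⟦iw⟧` as a relation between the operand and the returned (well-defined) value: "If the argument is […] poison, freeze returns
an arbitrary, but fixed, value […]. Otherwise, this instruction is a no-op and returns the input argument." = `LeeEtAl2017.IVal.FreezeResult`;
the result type `BitVec w` carries "The result of freeze instruction is well defined regardless of its operand" (L4614–4615).
[cite: LLVMLangRef18, §'freeze' L12191–12196; §'Well-Defined Values' L4614–4615] -/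
def IsFreezeOf (a : IVal w) (r : BitVec w) : Prop := ∀ v, a = some v → r = v

/-- The manual's freeze relation is PLDI'17's. [cite: LLVMLangRef18, §'freeze' L12191–12193] -/
theorem isFreezeOf_iff (a : IVal w) (r : BitVec w) : IsFreezeOf a r ↔ IVal.FreezeResult a r := by
  cases a with
  | none => simp [IsFreezeOf]
  | some v => simp [IsFreezeOf]

/-! ## `llvm.{s,u}{add,sub,mul}.with.overflow` (§L16397–16700) -/

/-- `llvm.sadd.with.overflow`: "the first element of which is the signed summation, and the second element of which is a bit specifying if the
signed summation resulted in an overflow." [cite: LLVMLangRef18, §'llvm.sadd.with.overflow.*' L16432–16436] -/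
def saddWithOverflowV (x y : BitVec w) : BitVec w × Bool := (x + y, BitVec.saddOverflow x y)
/-- `llvm.uadd.with.overflow`: "the first element of which is the sum, and the second element of which is a bit specifying if the unsigned
summation resulted in a carry." [cite: LLVMLangRef18, §'llvm.uadd.with.overflow.*' L16483–16486] -/
def uaddWithOverflowV (x y : BitVec w) : BitVec w × Bool := (x + y, BitVec.uaddOverflow x y)
/-- `llvm.ssub.with.overflow`. [cite: LLVMLangRef18, §'llvm.ssub.with.overflow.*' L16534–16538] -/
def ssubWithOverflowV (x y : BitVec w) : BitVec w × Bool := (x - y, BitVec.ssubOverflow x y)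
/-- `llvm.usub.with.overflow`. [cite: LLVMLangRef18, §'llvm.usub.with.overflow.*' L16585–16589] -/
def usubWithOverflowV (x y : BitVec w) : BitVec w × Bool := (x - y, BitVec.usubOverflow x y)
/-- `llvm.smul.with.overflow`. [cite: LLVMLangRef18, §'llvm.smul.with.overflow.*' L16635–16639] -/
def smulWithOverflowV (x y : BitVec w) : BitVec w × Bool := (x * y, BitVec.smulOverflow x y)
/-- `llvm.umul.with.overflow`. [cite: LLVMLangRef18, §'llvm.umul.with.overflow.*' L16686–16690] -/
def umulWithOverflowV (x y : BitVec w) : BitVec w × Bool := (x * y, BitVec.umulOverflow x y)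

/-- `*.with.overflow` on `⟦iw⟧`: a poison operand makes the whole returned structure poison (§'Poison Values' L4553–4554).
[cite: LLVMLangRef18, §'llvm.sadd.with.overflow.*' L16432–16436; §'Poison Values' L4553–4554] -/
def withOverflow (f : BitVec w → BitVec w → BitVec w × Bool) (a b : IVal w) : Option (BitVec w × Bool) :=
  a.bind fun x => b.bind fun y => some (f x y)

/-- The overflow bit of `uadd.with.overflow` is exactly the `nuw` poison condition of `add`: the flag and the intrinsic speak of the same
"unsigned overflow". [cite: LLVMLangRef18, §'add' L9270–9273; §'llvm.uadd.with.overflow.*' L16483–16486] -/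
theorem uaddWithOverflow_snd_iff (x y : BitVec w) : (uaddWithOverflowV x y).2 = true ↔ addV true false x y = IVal.poison := by
  rw [addV_nuw_eq_poison_iff]; rfl

/-- Likewise for the signed pair. [cite: LLVMLangRef18, §'add' L9270–9273; §'llvm.sadd.with.overflow.*' L16432–16436] -/
theorem saddWithOverflow_snd_iff (x y : BitVec w) : (saddWithOverflowV x y).2 = true ↔ addV false true x y = IVal.poison := by
  rw [addV_nsw_eq_poison_iff]; rfl

end Literature.Computability.LLVMLangRef18
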